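import Literature.AlgebraicGeometry.HodgeTheory.CycleClassPushforward
import Literature.AlgebraicGeometry.HodgeTheory.ComplexGysinHodgeType
import Literature.AlgebraicGeometry.HodgeTheory.ComplexGysinRational
import Literature.AlgebraicGeometry.HodgeTheory.HodgeFiltrationModelsReductionProofs
import Literature.AlgebraicGeometry.HodgeTheory.ComplexConjugationHolds
import Literature.AlgebraicGeometry.HodgeTheory.RationalClassesRingChange
import Literature.NumberTheory.Transcendental.DeRhamTheoremMultiplicative
import HarnessLib

/-!
# A Gysin / cycle-class formalism from the real Gysin maps and the cycle class through
# desingularisations, granted the degree formula and Lemma 9.18 for the orientation family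

Family `hodge`, layer `Literature/AlgebraicGeometry/HodgeTheory`. The hypothesis structure
`GysinFormalism` (`HodgeTheory/GysinFormalism`: Gysin morphisms and cycle classes on `H*(–(ℂ); ℂ)`
of smooth projective complex varieties with eight printed properties) is taken as a PARAMETER by the
proof of the Bloch–Srinivas theorem (`Barriers/HodgeConjecture/DecompositionOfTheDiagonalDegreeFour…`)
and its consumers; the tree deliberately has no existence fact for it ("the intended instance is to be
supplied by a CONSTRUCTION"). This file supplies that construction from

* the REAL Gysin morphisms `complexGysin μ` of an orientation family `μ` (`HodgeTheory/ComplexGysin`;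
  functoriality, projection formula and support PROVED there and in `SupportedHodgeClassDescent`,
  Poincaré duality being a theorem, `OrientationFamily.hasPoincareDuality`), and
* the REAL cycle class `cycleClass μ hX hde ρ` through a resolution family
  (`HodgeTheory/CycleClassOfResolutions`, Voisin I §11.1.4; resolution families exist by projective
  Hironaka, a theorem of the tree),

granted TWO hypotheses on `μ` — both theorems in print for the complex orientations, both false for a
general `μ`:

* `μ.HasDegreeFormula` (`HodgeTheory/CycleClassDegreeFormula`; Fulton, Lemma 19.1.2), which yields
  the fields `cl_primeCycle` (`[ι(V)] = ι_* 1`) and `cl_map` (Prop. 9.21 (ii)) there;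
* `μ.CycleClassDivEqZero` (this file; C. Voisin, *Hodge Theory and Complex Algebraic Geometry II*
  (2003), **Lemma 9.18**: "If `Z` is rationally equivalent to `0`, then `[Z] = 0`", in generator
  form: `[div φ] = 0` for `φ ∈ K(W)ˣ`, `W ⊆ X` a `(d+1)`-dimensional closed subvariety — Fulton §1.3),
  which yields the field `cl_congr` (`cycleClass_eq_of_isRationallyEquivalent`).

Results:

* `GysinFormalism.ofResolutions μ hB hC : GysinFormalism` — `gysin := complexGysin μ`,
  `cl := cycleClass μ` through a chosen resolution family (the choice is immaterial,
  `cycleClass_eq_of_hasDegreeFormula`);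
* `OrientationFamily.HasRationalFundamentalClasses μ` (each `[X(ℂ)]_μ` is the complexification of a
  rational fundamental class) and `isRationalClass_complexGysin_of_hasRationalFundamentalClasses`
  (then `complexGysin μ` preserves rational classes: on rational classes it IS the rational Gysin
  morphism, scalar `u = 1` in `complexGysin_ringChange_eq_smul_gysinMap`);
* `GysinFormalism.isGysinHodgeCompatible_ofResolutions` — the formalism is Gysin-Hodge-compatible
  (`GysinFormalism.IsGysinHodgeCompatible`: `f_*` preserves rational classes and Hodge bidegrees), the
  Hodge half being the tree's theorem `isOfHodgeType_complexGysin` fed with the theorems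
  `hodgePQ_independent_of_hodgeModel_holds`, `nonempty_hodgeModel_holds`, `exists_deRhamIsoFamily_holds`.

Hence every consumer of `(G : GysinFormalism) (hG : G.IsGysinHodgeCompatible)` holds for an
orientation family with rational fundamental classes satisfying the degree formula and Lemma 9.18 —
the complex orientation family (`HodgeTheory/ComplexOrientationFamily`).

## References

* [VoisinHodgeII2003] C. Voisin, Hodge Theory and Complex Algebraic Geometry II, CUP 2003, Lemma 9.18,
  Prop. 9.21 (ii), §9.2.2.
* [VoisinHodgeI2002] C. Voisin, Hodge Theory and Complex Algebraic Geometry I, CUP 2002, §7.3.2, §11.1.4.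
* [Fulton1998] W. Fulton, Intersection Theory, 2nd ed. 1998, §1.3, §1.4, Lemma 19.1.2, §19.1.
* [FultonYoungTableaux1997] W. Fulton, Young Tableaux, CUP 1997, App. B §B.1 (2)–(7), §B.2 Exercise 5.
* [HatcherAT2002] A. Hatcher, Algebraic Topology, CUP 2002, §3.3 Thm. 3.26, Thm. 3.30.
-/

noncomputable section

open CategoryTheory AlgebraicGeometry Order
open Literature.AlgebraicTopology.SingularHomology

namespace Literature.AlgebraicGeometry.HodgeTheory

section HodgeTheory

variable {m n : ℕ} {Y X : Motives.SchemeOver ℂ}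

/-- **`[Z] = 0` for `Z ∈ Rat_d X`**, granted Lemma 9.18 in generator form for `μ`: `Rat_d X` is the
subgroup generated by the `div φ` (`Motives.ratTrivial`), and the cycle class is additive.
[cite: VoisinHodgeII2003, Lemma 9.18] [cite: Fulton1998, §1.3] -/
theorem cycleClass_eq_zero_of_mem_ratTrivial {μ : OrientationFamily} (hC : μ.CycleClassDivEqZero)
    (hX : Motives.IsSmoothProjective n X) {d e : ℕ} (hde : d + e = n) (ρ : ResolutionFamily X d)
    {c : AlgebraicCycle X.left ℤ} (hc : c ∈ Motives.ratTrivial X.left d)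
    (hc' : c ∈ Motives.cyclesOfDim X.left d) : cycleClass μ hX hde ρ ⟨c, hc'⟩ = 0 := by
  revert hc'
  induction hc using AddSubgroup.closure_induction with
  | mem c hc =>
    intro hc'
    obtain ⟨-, W, _, φ, hφ, hW, hcφ⟩ := hc
    exact hC hX hde ρ W φ hφ hW hc' hcφ
  | zero => intro hc'; exact map_zero (cycleClass μ hX hde ρ)
  | add a b ha hb iha ihb =>
    intro hab
    have ha' : a ∈ Motives.cyclesOfDim X.left d := Motives.ratTrivial_le_cyclesOfDim X.left d ha
    have hb' : b ∈ Motives.cyclesOfDim X.left d := Motives.ratTrivial_le_cyclesOfDim X.left d hb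
    have h : (⟨a + b, hab⟩ : ↥(Motives.cyclesOfDim X.left d)) = ⟨a, ha'⟩ + ⟨b, hb'⟩ := rfl
    rw [h, map_add, iha ha', ihb hb', add_zero]
  | neg a ha iha =>
    intro hna
    have ha' : a ∈ Motives.cyclesOfDim X.left d := Motives.ratTrivial_le_cyclesOfDim X.left d ha
    have h : (⟨-a, hna⟩ : ↥(Motives.cyclesOfDim X.left d)) = -⟨a, ha'⟩ := rfl
    rw [h, map_neg, iha ha', neg_zero]

/-- **Lemma 9.18** ("If `Z` is rationally equivalent to `0`, then `[Z] = 0`"): rationally equivalent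
`d`-cycles have the same cycle class, granted the generator form for `μ` — the field `cl_congr` of
`GysinFormalism`. [cite: VoisinHodgeII2003, Lemma 9.18] -/
theorem cycleClass_eq_of_isRationallyEquivalent {μ : OrientationFamily} (hC : μ.CycleClassDivEqZero)
    (hX : Motives.IsSmoothProjective n X) {d e : ℕ} (hde : d + e = n) (ρ : ResolutionFamily X d)
    {Z Z' : ↥(Motives.cyclesOfDim X.left d)}
    (h : Motives.IsRationallyEquivalent (Z : AlgebraicCycle X.left ℤ) (Z' : AlgebraicCycle X.left ℤ) d) :
    cycleClass μ hX hde ρ Z = cycleClass μ hX hde ρ Z' := by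
  rw [← sub_eq_zero, ← map_sub]
  exact cycleClass_eq_zero_of_mem_ratTrivial hC hX hde ρ h (Z - Z').2

/-! ### Rationality of the Gysin morphisms -/

/-- **`complexGysin μ` on rational classes is the rational Gysin morphism** when `[Y(ℂ)]_μ`, `[X(ℂ)]_μ`
are complexified rational fundamental classes (the scalar of
`complexGysin_ringChange_eq_smul_gysinMap` is `1`: both `f_*`'s are `PD⁻¹ ∘ f(ℂ)_* ∘ PD`, and the
changes of coefficients commute with cap products and push-forwards).
[cite: FultonYoungTableaux1997, Appendix B §B.1 (5)] [cite: VoisinHodgeI2002, §7.3.2] -/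
theorem complexGysin_ringChange_of_coeffChange_fundamentalClass_eq {μ : OrientationFamily}
    (hY : Motives.IsSmoothProjective m Y) (hX : Motives.IsSmoothProjective n X) (f : Y ⟶ X)
    {a b q : ℕ} (ha : a + q = 2 * m) (hb : b + q = 2 * n)
    (νY : HomologicalOrientation ℚ (Motives.ComplexPoints Y) (2 * m))
    (νX : HomologicalOrientation ℚ (Motives.ComplexPoints X) (2 * n))
    (hνY : singularHomology.coeffChange (Motives.ComplexPoints Y) (algebraMap ℚ ℂ).toAddMonoidHom (2 * m)
        νY.fundamentalClass = (μ hY).fundamentalClass)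
    (hνX : singularHomology.coeffChange (Motives.ComplexPoints X) (algebraMap ℚ ℂ).toAddMonoidHom (2 * n)
        νX.fundamentalClass = (μ hX).fundamentalClass)
    (y : singularCohomology ℚ ℚ (Motives.ComplexPoints Y) a) :
    complexGysin μ hY hX f (show a + 2 * n = b + 2 * m by omega)
        (singularCohomology.ringChange (algebraMap ℚ ℂ) (Motives.ComplexPoints Y) a y) =
      singularCohomology.ringChange (algebraMap ℚ ℂ) (Motives.ComplexPoints X) b
        (gysinMap νY νX (Motives.AlgPoints.mapContinuous (L := ℂ) f) ha hb y) := by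
  have hμ : μ.HasPoincareDuality := OrientationFamily.hasPoincareDuality μ
  have hνXD : νX.HasPoincareDuality := by
    letI := hX.chartedSpace
    haveI := Motives.ComplexPoints.compactSpace_of_isSmoothProjective hX
    haveI := Motives.ComplexPoints.t2Space_of_isSmoothProjective hX
    exact HomologicalOrientation.HasPoincareDuality.of_bijective_poincareDualityMap
      (fun p q h ↦ poincare_duality _ h)
  have e1 : capProduct hb (singularCohomology.ringChange (algebraMap ℚ ℂ) (Motives.ComplexPoints X) b
        (gysinMap νY νX (Motives.AlgPoints.mapContinuous (L := ℂ) f) ha hb y))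
      (singularHomology.coeffChange (Motives.ComplexPoints X) (algebraMap ℚ ℂ).toAddMonoidHom (2 * n)
        νX.fundamentalClass) =
      singularHomology.map ℂ ℂ (Motives.AlgPoints.mapContinuous (L := ℂ) f) q
        (capProduct ha (singularCohomology.ringChange (algebraMap ℚ ℂ) (Motives.ComplexPoints Y) a y)
          (singularHomology.coeffChange (Motives.ComplexPoints Y) (algebraMap ℚ ℂ).toAddMonoidHom
            (2 * m) νY.fundamentalClass)) := by
    rw [← singularHomology.coeffChange_capProduct, capProduct_gysinMap hνXD _ ha hb y,
      singularHomology.coeffChange_map, singularHomology.coeffChange_capProduct]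
  rw [hνX, hνY] at e1
  apply (hμ hX hb).1
  rw [poincareDualityMap_apply, poincareDualityMap_apply, capProduct_complexGysin hμ hY hX f _ ha hb, e1]

/-- **`complexGysin μ` preserves rational classes when `μ` has rational fundamental classes** — the
field `isRationalClass_gysin` of `GysinFormalism.IsGysinHodgeCompatible` for `complexGysin μ` ("the
Gysin morphism `φ_*` … is a morphism of Hodge structures": it is defined over `ℚ`).
[cite: VoisinHodgeI2002, §7.3.2] -/
theorem isRationalClass_complexGysin_of_hasRationalFundamentalClasses {μ : OrientationFamily}
    (hμ : μ.HasRationalFundamentalClasses) (hY : Motives.IsSmoothProjective m Y)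
    (hX : Motives.IsSmoothProjective n X) (f : Y ⟶ X) {a b : ℕ} (hab : a + 2 * n = b + 2 * m)
    {w : complexBetti Y a} (hw : IsRationalClass w) :
    IsRationalClass (complexGysin μ hY hX f hab w) := by
  by_cases h : a ≤ 2 * m
  · obtain ⟨y, rfl⟩ := hw.exists_ringChange_eq
    obtain ⟨νY, hνY⟩ := hμ hY
    obtain ⟨νX, hνX⟩ := hμ hX
    rw [complexGysin_ringChange_of_coeffChange_fundamentalClass_eq hY hX f (q := 2 * m - a)
      (by omega) (by omega) νY νX hνY hνX]
    exact isRationalClass_ringChange _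
  · rw [complexGysin_of_lt hY hX f hab (not_le.1 h), LinearMap.zero_apply]
    exact IsRationalClass.zero

/-! ### Cycle classes are algebraic -/

/-- **Cycle classes are algebraic classes**: `[Z] ∈ Nᵉ H^{2e}(X(ℂ); ℂ) = algebraicClasses X e`
(`[Z]` dies off the closure of the support of `Z`, a closed set of points of codimension `≥ e`).
[cite: VoisinHodgeII2003, proof of Lemma 9.18] [cite: GrothendieckTopology1969, §1] -/
theorem cycleClass_mem_algebraicClasses (μ : OrientationFamily) (hX : Motives.IsSmoothProjective n X)
    {d e : ℕ} (hde : d + e = n) (ρ : ResolutionFamily X d) (Z : ↥(Motives.cyclesOfDim X.left d)) :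
    cycleClass μ hX hde ρ Z ∈ algebraicClasses X e := by
  have hfin := finite_support_of_isSmoothProjective hX (Z : AlgebraicCycle X.left ℤ)
  let S : Set X.left := ⋃ z ∈ Function.support (Z : AlgebraicCycle X.left ℤ), closure {z}
  have hS : IsClosed S := hfin.isClosed_biUnion fun _ _ ↦ isClosed_closure
  refine mem_supportedClasses_of_restrictCompl_eq_zero hS (fun x hx ↦ ?_)
    (cycleClass_restrictCompl_eq_zero μ hX hde ρ Z hS fun z hz ↦
      Set.mem_biUnion hz (subset_closure (Set.mem_singleton z)))
  obtain ⟨z, hz, hxz⟩ := Set.mem_iUnion₂.mp hx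
  have hzd : Order.height z = d := Z.2 z hz
  obtain ⟨a, c, ha, hc, hac⟩ := exists_height_eq_coheight_eq hX x
  have h1 := height_le_height_of_mem_closure hxz
  rw [ha, hzd] at h1
  have h1' : a ≤ d := by exact_mod_cast h1
  rw [hc]
  exact_mod_cast (show e ≤ c by omega)

/-! ### The formalism -/

/-- **A Gysin / cycle-class formalism with Hodge-compatible Gysin morphisms EXISTS for every
orientation family with rational fundamental classes satisfying the degree formula and Lemma 9.18**
(hence for the complex orientation family, for which both are theorems in print): its Gysin morphisms
ARE the real `complexGysin μ = PD⁻¹ ∘ f(ℂ)_* ∘ PD` (Fulton App. B (5); `(𝟙)_* = 𝟙`, `(g ≫ f)_* = f_* g_*`,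
projection formula, support: theorems of `HodgeTheory/ComplexGysin` and `SupportedHodgeClassDescent`)
and its cycle classes ARE the real `cycleClass μ` through resolution families (Voisin I §11.1.4;
support: `cycleClass_restrictCompl_eq_zero`; `[ι(V)] = ι_* 1` and `cl ∘ f_* = f_* ∘ cl` from the degree
formula; `cl_congr` from Lemma 9.18); Hodge compatibility: rational classes by
`isRationalClass_complexGysin_of_hasRationalFundamentalClasses`, bidegree by the tree's theorem
`isOfHodgeType_complexGysin` (fed with `hodgePQ_independent_of_hodgeModel_holds`,
`nonempty_hodgeModel_holds`, `exists_deRhamIsoFamily_holds`). The structure is built inside the proof;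
this is the intended instance of `GysinFormalism`, so every consumer of
`(G : GysinFormalism) (hG : G.IsGysinHodgeCompatible)` follows from the three hypotheses on `μ`.
[cite: FultonYoungTableaux1997, Appendix B §B.1 (2)–(7) and §B.2 Exercise 5]
[cite: VoisinHodgeI2002, §7.3.2 and §11.1.4] [cite: VoisinHodgeII2003, Lemma 9.18 and Prop. 9.21 (ii)]
[cite: Fulton1998, Lemma 19.1.2] -/
theorem exists_gysinFormalism_isGysinHodgeCompatible {μ : OrientationFamily}
    (hB : μ.HasDegreeFormula) (hC : μ.CycleClassDivEqZero) (hR : μ.HasRationalFundamentalClasses) :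
    ∃ G : GysinFormalism, G.IsGysinHodgeCompatible ∧
      (∀ ⦃m n : ℕ⦄ ⦃Y X : Motives.SchemeOver ℂ⦄ (hY : Motives.IsSmoothProjective m Y)
        (hX : Motives.IsSmoothProjective n X) (f : Y ⟶ X) ⦃a b : ℕ⦄ (hab : a + 2 * n = b + 2 * m),
          G.gysin hY hX f hab = complexGysin μ hY hX f hab) ∧
      (∀ ⦃n : ℕ⦄ ⦃X : Motives.SchemeOver ℂ⦄ (hX : Motives.IsSmoothProjective n X) ⦃d e : ℕ⦄
        (hde : d + e = n), ∃ ρ : ResolutionFamily X d, G.cl hX hde = cycleClass μ hX hde ρ) := by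
  have ρ : ∀ ⦃n : ℕ⦄ ⦃X : Motives.SchemeOver ℂ⦄ (_ : Motives.IsSmoothProjective n X) (d : ℕ),
      ResolutionFamily X d := fun _ _ hX d ↦ (nonempty_resolutionFamily hX d).some
  refine ⟨{ gysin := fun hY hX f _ _ hab ↦ complexGysin μ hY hX f hab
            gysin_id := fun hX a ↦ complexGysin_id (OrientationFamily.hasPoincareDuality μ) hX a
            gysin_comp := fun hZ hY hX g f _ _ _ hab hbc ↦
              complexGysin_comp (OrientationFamily.hasPoincareDuality μ) hZ hY hX g f hab hbc
            gysin_cup := fun hY hX f _ _ _ _ _ hpq hab hq hpq' x y ↦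
              complexGysin_cup (OrientationFamily.hasPoincareDuality μ) hY hX f hpq hab hq hpq' x y
            gysin_restrictCompl_eq_zero := fun hY hX f _ _ hab _ hT y hy ↦
              complexGysin_restrictCompl_eq_zero (gysinMap_restrictCompl_eq_zero_of_field ℂ) μ
                (OrientationFamily.hasPoincareDuality μ) hY hX f hab hT y hy
            cl := fun hX d _ hde ↦ cycleClass μ hX hde (ρ hX d)
            cl_congr := fun hX _ _ hde _ _ h ↦ cycleClass_eq_of_isRationallyEquivalent hC hX hde _ h
            cl_restrictCompl_eq_zero := fun hX _ _ hde Z _ hS hZ ↦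
              cycleClass_restrictCompl_eq_zero μ hX hde _ Z hS hZ
            cl_primeCycle := fun hV hX ι _ _ hde δ hδ hmem ↦
              cycleClass_primeCycle_of_isClosedImmersion hB hV hX ι hde _ δ hδ hmem
            cl_map := fun hY hX f _ _ _ hde hde' Z ↦
              cycleClass_cyclesOfDimMap hB hY hX f hde hde' _ _ Z },
    ⟨fun hY hX f _ _ hab _ hy ↦ ?_, fun hY hX f _ _ hab _ _ _ _ hp hq _ hy ↦ ?_⟩,
    fun _ _ _ _ hY hX f _ _ hab ↦ rfl, fun _ _ hX d _ hde ↦ ⟨ρ hX d, rfl⟩⟩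
  · exact isRationalClass_complexGysin_of_hasRationalFundamentalClasses hR hY hX f hab hy
  · exact isOfHodgeType_complexGysin hodgePQ_independent_of_hodgeModel_holds
      (fun _ _ ↦ nonempty_hodgeModel_holds)
      (fun E _ _ _ ↦ Literature.NumberTheory.Transcendental.exists_deRhamIsoFamily_holds E) μ hY hX f
      hab hp hq hy

end HodgeTheory

end Literature.AlgebraicGeometry.HodgeTheory

end
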